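import Summits.ABC.ABC.Theses.RibetTakahashiSplit
import Summits.ABC.ABC.Theorems.RibetTakahashiSplitManyPrimeValuationProductStubFermatInputKnown
import Summits.ABC.ABC.Theorems.RibetTakahashiSplitFewPrimeValuationProductStubDepthSemistable
import Literature.NumberTheory.EllipticCurves.PastenValuationProduct
import Literature.NumberTheory.EllipticCurves.ShafarevichGoodReduction
import Literature.NumberTheory.EllipticCurves.ModularityVersionApProofs
import Literature.NumberTheory.DiophantineGeometry.ConductorRadicalProofs

/-!
# Stub `stub_depthResidual` of line `switching-triangle` (crux stmt-ABC-1563): the small-prime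
# depth (hypothesis 3 of `stub_depthResidual_of_hasse`) from Pasten's Lemma 6.10 and Shafarevich

Helper (`--supports stmt-ABC-1563`) for the registered stub `stub_depthResidual` of the line
`switching-triangle` for the crux `Summit.ABC.ABC.Theses.RibetTakahashiSplit.FewPrimeValuationProduct`,
through the landed reduction `stub_depthResidual_of_hasse`
(`RibetTakahashiSplitFewPrimeValuationProductStubDepthResidual.lean`), whose THIRD hypothesis —
the "small-prime depth" of the sibling line `hasse-pinning-fixed-level` — is proved here
conditionally on two named facts. Notation: `N = W.conductorNorm ℤ` is the conductor,
`Mult(W) = {p ∣ N prime : p² ∤ N}` the set of multiplicative primes,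
`c_p = (W.minimalDiscriminantNorm ℤ).factorization p = ord_p Δ_min`; `W` is semistable away from
`2` (`p² ∤ N` for odd `p`, hypothesis H_sf of the crux class).

SMALL-PRIME DEPTH: for every prime `ℓ` there is `B = B(ℓ)` such that, on the crux class, every
prime power `ℓ^m` dividing all the `c_p`, `p ∈ Mult(W)`, is `≤ B`. Proof (Pasten,
arXiv:1705.09251, proof of Thm. 6.17 for `ℓ ≤ 7`, "Lemma 6.10 at `L = ℓ³`"): if `m ≤ 2` then
`ℓ^m ≤ ℓ²`. If `m ≥ 3` then `ℓ³ ∣ c_p` for every `p ∈ Mult(W)`; every ODD prime of `Δ_min` is a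
prime of `N` (`rad N = rad Δ_min`, `WeierstrassCurve.radical_conductorNorm_eq_holds`) with
`p² ∤ N` (H_sf), i.e. lies in `Mult(W)`, so every odd-prime exponent of `|Δ_min|` is divisible by
`ℓ³` and `|Δ_min| = 2^e · k^{ℓ³}`
(`Summit.ABC.ABC.Theorems.ManyPrimeValuationProduct.exists_eq_two_pow_mul_pow_of_dvd_factorization`).
By **Pasten's Lemma 6.10** (`L = ℓ³ ≥ 8`, `S = {2}`) such a curve has conductor `N < N₀(ℓ³, {2})`,
hence, by **Shafarevich's theorem in conductor form** (finitely many `ℚ`-isomorphism classes of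
conductor `< N₀`, so `|Δ_min| ≤ D(N₀)`), `ℓ^m ≤ c_p < |Δ_min| ≤ D` for any `p ∈ Mult(W)`
(`Mult(W) ≠ ∅` and `c_p ≥ 1` are hypotheses of the registered statement). So
`B(ℓ) = max(ℓ², D(N₀(ℓ³, {2})))`.

Contents:
* two NAMED FACTS (D-0014; `Prop`-valued `def`s taken as hypotheses, stated in the tree's
  vocabulary, to be relocated by the gate into
  `Literature/NumberTheory/EllipticCurves/PastenValuationProduct.lean`):
  `Literature.NumberTheory.EllipticCurves.PastenShimura2024_lemma_6_10` (Pasten 2024, Lemma 6.10,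
  verbatim up to the dictionary "semistable away from `S`" = "`p² ∤ N_E` for primes `p ∉ S`",
  `|Δ_E| = W.minimalDiscriminantNorm ℤ`) and
  `Literature.NumberTheory.EllipticCurves.shafarevich_minimalDiscriminantNorm_bounded`
  (Silverman AEC Thm. IX.6.1 in conductor form: `|Δ_min|` is bounded in terms of the conductor);
* `shafarevich_minimalDiscriminantNorm_bounded_of_shafarevich` — the second fact PROVED from the
  tree's rendering `WeierstrassCurve.shafarevich_finite_goodReductionOutside ℚ` of AEC IX.6.1
  (bad places of `𝓞 ℚ` lie over primes dividing `N`, `WeierstrassCurve.dvd_conductorNorm_iff`;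
  `|Δ_min|` is a `ℚ`-isomorphism invariant, `WeierstrassCurve.minimalDiscriminantNorm_smul_rat`),
  so that hypothesis 2 of the stub costs exactly Shafarevich's theorem;
* `smallPrimeDepth_le_of_facts` (curried, with the bound `max(ℓ², D)` explicit in the proof) and
  the registered uncurried statement `smallPrimeDepth_of_facts` (hypothesis 3 of
  `stub_depthResidual_of_hasse`, verbatim).

Not here: Pasten's Lemma 6.10 itself (Darmon–Granville's Theorem 2 with `S`-coprimality for
`A x^L = y³ − z²`, Faltings; SIZE XL) and Shafarevich's theorem (Siegel); the other two
hypotheses of `stub_depthResidual_of_hasse` (fixed-level congruence, least distinguishing prime),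
which stay open.

References: H. Pasten, *Shimura curves and the abc conjecture*, J. Number Theory 254 (2024)
214–335 = arXiv:1705.09251, §6.5 Lemma 6.10 (held text p. 22) and proof of Thm. 6.17 (p. 24);
J. H. Silverman, *The Arithmetic of Elliptic Curves*, 2nd ed., GTM 106 (2009), Thm. IX.6.1,
App. C §16, VIII.8.
-/

open IsDedekindDomain NumberField

namespace Literature.NumberTheory.EllipticCurves

end Literature.NumberTheory.EllipticCurves

-- `Summit.<Summit>.<Problem>` is the mandated summit-side namespace (CONVENTIONS §2); for the
-- single-conjunct summit `ABC` the two coincide, so the duplicate `ABC.ABC` is deliberate.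
set_option linter.dupNamespace false

namespace Summit.ABC.ABC.Theorems.FewPrimeValuationProduct

open WeierstrassCurve Rat.HeightOneSpectrum

/-- **Shafarevich ⟹ Shafarevich in conductor form.** The named fact
`Literature.NumberTheory.EllipticCurves.shafarevich_minimalDiscriminantNorm_bounded` follows from
the tree's rendering `WeierstrassCurve.shafarevich_finite_goodReductionOutside ℚ` of Silverman AEC
Thm. IX.6.1: take `S` = the finite set of places of `𝓞 ℚ` over primes `< N₀`; a bad place `v` of
an elliptic `W` lies over a prime dividing `N` (`WeierstrassCurve.dvd_conductorNorm_iff`, AEC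
App. C §16), hence in `S` when `N < N₀`; so `C • W ∈ F` for the finite set `F` of IX.6.1 and some
change of variables `C`, and `|Δ_min(W)| = |Δ_min(C • W)| ≤ max_F |Δ_min|`
(`WeierstrassCurve.minimalDiscriminantNorm_smul_rat`, AEC VIII.8).
[cite: SilvermanAEC2009, Thm. IX.6.1 with App. C §16 and VIII.8] -/
theorem shafarevich_minimalDiscriminantNorm_bounded_of_shafarevich
    (hSha : WeierstrassCurve.shafarevich_finite_goodReductionOutside ℚ) :
    Literature.NumberTheory.EllipticCurves.shafarevich_minimalDiscriminantNorm_bounded := by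
  intro N₀
  -- the places of `𝓞 ℚ` over the primes `< N₀`
  set f : HeightOneSpectrum (𝓞 ℚ) → ℕ := fun v => ((primesEquiv v : Nat.Primes) : ℕ)
  have hfi : Function.Injective f :=
    Nat.Primes.coe_nat_injective.comp (primesEquiv (R := 𝓞 ℚ)).injective
  have hS : (f ⁻¹' {i | i < N₀}).Finite := (Set.finite_lt_nat N₀).preimage hfi.injOn
  obtain ⟨F, hF⟩ := hSha (f ⁻¹' {i | i < N₀}) hS
  refine ⟨F.sup fun W' => W'.minimalDiscriminantNorm ℤ, fun W _ hN => ?_⟩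
  have hNpos : 0 < W.conductorNorm ℤ := W.conductorNorm_pos_holds
  have hbad : W.badPlaces (𝓞 ℚ) ⊆ f ⁻¹' {i | i < N₀} := fun v hv =>
    show ((primesEquiv v : Nat.Primes) : ℕ) < N₀ from
      lt_of_le_of_lt (Nat.le_of_dvd hNpos ((W.dvd_conductorNorm_iff v).mpr hv)) hN
  obtain ⟨C, hC⟩ := hF W hbad
  rw [← minimalDiscriminantNorm_smul_rat W C]
  exact Finset.le_sup (f := fun W' : WeierstrassCurve ℚ => W'.minimalDiscriminantNorm ℤ) hC

/-- On the crux class (semistable away from `2`), if `d` divides every `c_p`, `p ∈ Mult(W)`, then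
`d` divides every ODD-prime exponent of `|Δ_min|`: an odd prime of `Δ_min` is a prime of `N`
(`primeFactors N = primeFactors Δ_min`, the landed `depthSemistable_primeFactors_eq`, from
`WeierstrassCurve.radical_conductorNorm_eq_holds`) with `p² ∤ N`, i.e. a multiplicative prime, and
the other exponents vanish. `[folklore]` -/
theorem smallPrimeDepth_dvd_factorization_of_odd (W : WeierstrassCurve ℚ) [W.IsElliptic]
    (hss : ∀ p : ℕ, p.Prime → p ≠ 2 → ¬ p ^ 2 ∣ W.conductorNorm ℤ) {d : ℕ}
    (hd : ∀ p ∈ (W.conductorNorm ℤ).primeFactors.filter (fun p => ¬ p ^ 2 ∣ W.conductorNorm ℤ),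
      d ∣ (W.minimalDiscriminantNorm ℤ).factorization p)
    {p : ℕ} (hp : p.Prime) (hp2 : p ≠ 2) :
    d ∣ (W.minimalDiscriminantNorm ℤ).factorization p := by
  by_cases hpΔ : p ∣ W.minimalDiscriminantNorm ℤ
  · have hΔ0 : W.minimalDiscriminantNorm ℤ ≠ 0 := (W.minimalDiscriminantNorm_pos_holds).ne'
    have hpN : p ∈ (W.conductorNorm ℤ).primeFactors := by
      rw [depthSemistable_primeFactors_eq W]
      exact Nat.mem_primeFactors.mpr ⟨hp, hpΔ, hΔ0⟩
    exact hd p (Finset.mem_filter.mpr ⟨hpN, hss p hp hp2⟩)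
  · rw [Nat.factorization_eq_zero_of_not_dvd hpΔ]
    exact dvd_zero d

/-- The prime factors of a power of `2` lie in `{2}`. `[folklore]` -/
theorem smallPrimeDepth_primeFactors_two_pow_subset (e : ℕ) :
    (2 ^ e).primeFactors ⊆ ({2} : Finset ℕ) := by
  intro q hq
  have hqp : q.Prime := Nat.prime_of_mem_primeFactors hq
  have hq2 : q ∣ 2 := hqp.dvd_of_dvd_pow (Nat.dvd_of_mem_primeFactors hq)
  exact Finset.mem_singleton.mpr ((Nat.prime_dvd_prime_iff_eq hqp Nat.prime_two).mp hq2)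

/-- **Small-prime depth, curried form.** Assume Pasten's Lemma 6.10 (`hP`) and Shafarevich's
theorem in conductor form (`hSh`). For every prime `ℓ` there is `B` (namely
`max(ℓ², D(N₀(ℓ³, {2})))`) such that for every elliptic `W / ℚ` semistable away from `2` with
`Mult(W) ≠ ∅` and `c_p ≥ 1` on `Mult(W)`, every `ℓ^m` dividing all `c_p`, `p ∈ Mult(W)`, is
`≤ B`: for `m ≤ 2` trivially; for `m ≥ 3`, `|Δ_min| = 2^e · k^{ℓ³}`
(`smallPrimeDepth_dvd_factorization_of_odd`,
`ManyPrimeValuationProduct.exists_eq_two_pow_mul_pow_of_dvd_factorization`), so `N < N₀` by `hP`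
at `L = ℓ³ ≥ 8`, `S = {2}`, so `|Δ_min| ≤ D` by `hSh`, and `ℓ^m ≤ c_p < |Δ_min|`
(`Nat.factorization_lt`). Pasten, proof of Thm. 6.17 (`ℓ ≤ 7`: "Lemma 6.10 at `L = ℓ³`").
[cite: PastenShimura2024, Thm. 6.17 (proof, case ℓ ≤ 7) with Lemma 6.10] -/
theorem smallPrimeDepth_le_of_facts
    (hP : Literature.NumberTheory.EllipticCurves.PastenShimura2024_lemma_6_10)
    (hSh : Literature.NumberTheory.EllipticCurves.shafarevich_minimalDiscriminantNorm_bounded)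
    {ℓ : ℕ} (hℓ : ℓ.Prime) :
    ∃ B : ℝ, ∀ (W : WeierstrassCurve ℚ) [W.IsElliptic],
      (∀ p : ℕ, p.Prime → p ≠ 2 → ¬ p ^ 2 ∣ W.conductorNorm ℤ) →
      ((W.conductorNorm ℤ).primeFactors.filter (fun p => ¬ p ^ 2 ∣ W.conductorNorm ℤ)).Nonempty →
      (∀ p ∈ (W.conductorNorm ℤ).primeFactors.filter (fun p => ¬ p ^ 2 ∣ W.conductorNorm ℤ),
        0 < (W.minimalDiscriminantNorm ℤ).factorization p) →
      ∀ m : ℕ,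
        (∀ p ∈ (W.conductorNorm ℤ).primeFactors.filter (fun p => ¬ p ^ 2 ∣ W.conductorNorm ℤ),
          ℓ ^ m ∣ (W.minimalDiscriminantNorm ℤ).factorization p) → ((ℓ ^ m : ℕ) : ℝ) ≤ B := by
  -- Pasten's Lemma 6.10 at `L = ℓ³ ≥ 8`, `S = {2}`, then Shafarevich below the threshold `N₀`
  have hL : 7 ≤ ℓ ^ 3 :=
    calc 7 ≤ 2 ^ 3 := by norm_num
      _ ≤ ℓ ^ 3 := Nat.pow_le_pow_left hℓ.two_le 3
  obtain ⟨N₀, hN₀⟩ := hP (ℓ ^ 3) hL {2}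
  obtain ⟨D, hD⟩ := hSh N₀
  refine ⟨max ((ℓ ^ 2 : ℕ) : ℝ) (D : ℝ), fun W _ hss hne hpos m hm => ?_⟩
  by_cases hm2 : m ≤ 2
  · -- small exponent: `ℓ^m ≤ ℓ²`
    have h : ℓ ^ m ≤ ℓ ^ 2 := Nat.pow_le_pow_right hℓ.pos hm2
    calc ((ℓ ^ m : ℕ) : ℝ) ≤ ((ℓ ^ 2 : ℕ) : ℝ) := by exact_mod_cast h
      _ ≤ max ((ℓ ^ 2 : ℕ) : ℝ) (D : ℝ) := le_max_left _ _
  · -- `m ≥ 3`: `ℓ³` divides every odd-prime exponent of `|Δ_min|`, so `|Δ_min| = 2^e · k^{ℓ³}`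
    have h3m : 3 ≤ m := by omega
    have hΔ0 : W.minimalDiscriminantNorm ℤ ≠ 0 := (W.minimalDiscriminantNorm_pos_holds).ne'
    have hdvd : ∀ p : ℕ, p.Prime → p ≠ 2 → ℓ ^ 3 ∣ (W.minimalDiscriminantNorm ℤ).factorization p :=
      fun p hp hp2 => smallPrimeDepth_dvd_factorization_of_odd W hss
        (fun q hq => (pow_dvd_pow ℓ h3m).trans (hm q hq)) hp hp2
    obtain ⟨k, -, hk⟩ := ManyPrimeValuationProduct.exists_eq_two_pow_mul_pow_of_dvd_factorization
      hΔ0 (pow_ne_zero 3 hℓ.ne_zero) hdvd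
    -- Pasten's Lemma 6.10: the conductor is below the threshold `N₀`
    have hlt : W.conductorNorm ℤ < N₀ := by
      by_contra hge
      exact hN₀ W (fun p hp hpS => hss p hp fun h => hpS (Finset.mem_singleton.mpr h))
        (not_lt.mp hge) (2 ^ (W.minimalDiscriminantNorm ℤ).factorization 2) k
        (smallPrimeDepth_primeFactors_two_pow_subset _) hk
    -- Shafarevich: `|Δ_min| ≤ D`; and `ℓ^m ≤ c_p < |Δ_min|` at any multiplicative prime `p`
    have hΔD : W.minimalDiscriminantNorm ℤ ≤ D := hD W hlt
    obtain ⟨p, hp⟩ := hne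
    have h1 : ℓ ^ m ≤ (W.minimalDiscriminantNorm ℤ).factorization p :=
      Nat.le_of_dvd (hpos p hp) (hm p hp)
    have h2 : (W.minimalDiscriminantNorm ℤ).factorization p < W.minimalDiscriminantNorm ℤ :=
      Nat.factorization_lt p hΔ0
    calc ((ℓ ^ m : ℕ) : ℝ) ≤ (D : ℝ) := by exact_mod_cast h1.trans (h2.le.trans hΔD)
      _ ≤ max ((ℓ ^ 2 : ℕ) : ℝ) (D : ℝ) := le_max_right _ _

/-- **Small-prime depth (registered stub-level statement `smallPrimeDepth_of_facts`, = hypothesis 3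
of `stub_depthResidual_of_hasse`, PROVED conditionally).** Pasten's Lemma 6.10
(`Literature.NumberTheory.EllipticCurves.PastenShimura2024_lemma_6_10`) and Shafarevich's theorem
in conductor form (`Literature.NumberTheory.EllipticCurves.shafarevich_minimalDiscriminantNorm_bounded`,
itself a consequence of `WeierstrassCurve.shafarevich_finite_goodReductionOutside ℚ` by
`shafarevich_minimalDiscriminantNorm_bounded_of_shafarevich`) imply: for every prime `ℓ` there is
`B` such that on the crux class (semistable away from `2`, `≤ 3` odd multiplicative primes — not
used —, `Mult(W) ≠ ∅`, `c_p ≥ 1` on `Mult(W)`) every `ℓ^m` dividing all the `c_p`,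
`p ∈ Mult(W)`, satisfies `ℓ^m ≤ B`. Uncurried `smallPrimeDepth_le_of_facts`.
[cite: PastenShimura2024, Thm. 6.17 (proof, case ℓ ≤ 7) with Lemma 6.10] -/
theorem smallPrimeDepth_of_facts : Literature.NumberTheory.EllipticCurves.PastenShimura2024_lemma_6_10 → Literature.NumberTheory.EllipticCurves.shafarevich_minimalDiscriminantNorm_bounded → ∀ ℓ : ℕ, ℓ.Prime → ∃ B : ℝ, ∀ (W : WeierstrassCurve ℚ) [W.IsElliptic], (∀ p : ℕ, p.Prime → p ≠ 2 → ¬ p ^ 2 ∣ W.conductorNorm ℤ) → ((W.conductorNorm ℤ).primeFactors.filter (fun p => p ≠ 2 ∧ ¬ p ^ 2 ∣ W.conductorNorm ℤ)).card ≤ 3 → ((W.conductorNorm ℤ).primeFactors.filter (fun p => ¬ p ^ 2 ∣ W.conductorNorm ℤ)).Nonempty → (∀ p ∈ (W.conductorNorm ℤ).primeFactors.filter (fun p => ¬ p ^ 2 ∣ W.conductorNorm ℤ), 0 < (W.minimalDiscriminantNorm ℤ).factorization p) → ∀ m : ℕ, (∀ p ∈ (W.conductorNorm ℤ).primeFactors.filter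 (fun p => ¬ p ^ 2 ∣ W.conductorNorm ℤ), ℓ ^ m ∣ (W.minimalDiscriminantNorm ℤ).factorization p) → ((ℓ ^ m : ℕ) : ℝ) ≤ B := by
  intro hP hSh ℓ hℓ
  obtain ⟨B, hB⟩ := smallPrimeDepth_le_of_facts hP hSh hℓ
  exact ⟨B, fun W _ hss _ hne hpos m hm => hB W hss hne hpos m hm⟩

end Summit.ABC.ABC.Theorems.FewPrimeValuationProduct
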